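import Mathlib.Geometry.Manifold.LocalDiffeomorph
import Mathlib.Geometry.Manifold.ContMDiff.Atlas
import Mathlib.Geometry.Manifold.ContMDiff.NormedSpace
import Literature.Topology.DirectLimitOpenEmbedding
import HarnessLib

/-!
# The direct limit of a directed system of manifolds along open embeddings is a manifold

For a directed system of `C^∞` manifolds `M i` modelled on a real normed space `E` (model
`𝓘(ℝ, E)`, no boundary), `i` in a directed preorder `ι`, whose transition maps
`φ i j h : M i → M j` (`i ≤ j`) are **injective local diffeomorphisms** — equivalently smooth open
embeddings with smooth inverses, e.g. isometric immersions between globally hyperbolic developments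
of the same data (Sbierski 2016, Lemma 9) — the direct limit `lim M` (Mathlib's `DirectLimit`,
the quotient of `Σ i, M i`; topology in `Literature.Topology.DirectLimitOpenEmbedding`) is a `C^∞`
manifold modelled on `E` in which every canonical map `M i → lim M` is a smooth open embedding and a
local diffeomorphism. This is the manifold `K̃ = ⋃ N_α` of Choquet-Bruhat–Geroch (Comm. Math.
Phys. 14 (1969), proof of Thm. 3, p. 333: *"the union of a totally ordered family of developments
… is a manifold"*), i.e. the smooth layer of the union-of-a-chain construction recorded as missing in
`Literature.Geometry.Lorentzian.CauchyProblemMGHDExistenceProofs` (§ "What remains", item (a));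
cf. Kosinski, *Differential Manifolds* (1993), VI.1 for the two-piece pushout
(`Literature.Topology.FourManifolds.SmoothGlueData`, whose maximal-atlas device is reused here).

* `SmoothDirectLimitData E ι` — the datum (universe polymorphic in the pieces, the model space and the
  index type independently): types `obj i` with their manifold structures, transition
  maps `map i j h : C(obj i, obj j)` forming a `DirectedSystem`, injective local diffeomorphisms;
  `d.Limit`, `d.incl i : d.obj i → d.Limit`;
* `d.isOpenEmbedding_map`, `d.isOpenEmbedding_incl`, `d.incl_eq_incl_iff_of_le` (two points agree in the
  limit iff they agree in any common later piece), Hausdorff / connected / second countable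
  criteria transported from `DirectLimitOpenEmbedding`;
* `IsLocalDiffeomorph.contMDiffOn_symm_of_injective` — the inverse of an injective local
  diffeomorphism is smooth on its (open) range;
* `d.overlap i j k` — the change-of-piece partial diffeomorphism `φ_{jk}⁻¹ ∘ φ_{ik} : M i ⇀ M j`
  governing `incl i x = incl j y`, smooth (`d.contMDiffOn_overlap`);
* `d.chartLift i e` — the lift to the limit of a chart `e` of `M i`; the atlas of `d.Limit` is the
  set of lifts of all charts of the maximal atlases of the pieces (`instChartedSpace`), and changes
  of such charts are smooth (`d.contDiffOn_chartLift_symm_trans_chartLift`), whence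
  `instIsManifold : IsManifold 𝓘(ℝ, E) ∞ d.Limit`;
* `d.contMDiff_incl`, `d.contMDiffOn_inclSymm`, `d.isLocalDiffeomorph_incl` — the canonical maps are
  smooth local diffeomorphisms onto open subsets.

## References

* Y. Choquet-Bruhat, R. Geroch, Comm. Math. Phys. 14 (1969) 329–335, proof of Thm. 3, p. 333.
  [ChoquetBruhatGeroch1969CMP]
* A. Kosinski, *Differential Manifolds*, Academic Press 1993, VI.1 and I.(5.1). [folklore]
* J. Sbierski, Ann. Henri Poincaré 17 (2016) 301–329, §3.1 Lemma 9, §3.3. [Sbierski2016AHP]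
-/

open scoped Manifold ContDiff Topology
open Set Function _root_.Topology OpenPartialHomeomorph

noncomputable section

namespace Literature.Geometry.Manifold

universe u v w

/-! ### Inverses of injective local diffeomorphisms -/

section LocalDiffeo

variable {E : Type*} [NormedAddCommGroup E] [NormedSpace ℝ E] {H : Type*} [TopologicalSpace H]
  {I : ModelWithCorners ℝ E H} {M : Type*} [TopologicalSpace M] [ChartedSpace H M]
  {E' : Type*} [NormedAddCommGroup E'] [NormedSpace ℝ E'] {H' : Type*} [TopologicalSpace H']
  {J : ModelWithCorners ℝ E' H'} {N : Type*} [TopologicalSpace N] [ChartedSpace H' N]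
  {n : ℕ∞ω} {f : M → N}

/-- An injective local diffeomorphism is an open embedding. [folklore] -/
theorem _root_.IsLocalDiffeomorph.isOpenEmbedding_of_injective (hf : IsLocalDiffeomorph I J n f)
    (hinj : Injective f) : IsOpenEmbedding f :=
  .of_continuous_injective_isOpenMap hf.isLocalHomeomorph.continuous hinj hf.isOpenMap

/-- **The inverse of an injective `C^n` local diffeomorphism is `C^n` on its range**: near a point
`f x` of the range it agrees with the inverse of a partial diffeomorphism representing `f` at `x`.
[folklore] -/
theorem _root_.IsLocalDiffeomorph.contMDiffOn_symm_of_injective [Nonempty M]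
    (hf : IsLocalDiffeomorph I J n f) (hinj : Injective f) :
    ContMDiffOn J I n ((hf.isOpenEmbedding_of_injective hinj).toOpenPartialHomeomorph f).symm
      (range f) := by
  set e := (hf.isOpenEmbedding_of_injective hinj).toOpenPartialHomeomorph f with he
  rintro _ ⟨x, rfl⟩
  obtain ⟨Φ, hxΦ, heq⟩ := hf x
  have hfx : f x = Φ x := heq hxΦ
  have hfxt : f x ∈ Φ.target := hfx ▸ Φ.toPartialEquiv.map_source hxΦ
  -- on `Φ.target` the inverse of `f` is the inverse of `Φ`
  set g : N → M := ⇑Φ.toPartialEquiv.symm with hg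
  have hev : EqOn e.symm g Φ.target := by
    intro y hy
    have hy' : g y ∈ Φ.source := Φ.toPartialEquiv.map_target hy
    have h1 : f (g y) = y := (heq hy').trans (Φ.toPartialEquiv.right_inv hy)
    have h2 : e.symm (f (g y)) = g y :=
      (hf.isOpenEmbedding_of_injective hinj).toOpenPartialHomeomorph_left_inv f
    rw [← h2, h1]
  have hnhds : Φ.target ∈ 𝓝[range f] f x :=
    mem_nhdsWithin_of_mem_nhds (Φ.open_target.mem_nhds hfxt)
  have hgs : ContMDiffOn J I n g Φ.target := Φ.contMDiffOn_invFun
  refine ((hgs.contMDiffAt (Φ.open_target.mem_nhds hfxt)).contMDiffWithinAt).congr_of_eventuallyEq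
    ?_ ?_
  · exact Filter.eventuallyEq_of_mem hnhds fun y hy ↦ hev hy
  · exact hev hfxt

end LocalDiffeo

/-! ### The datum of a smooth directed system of open embeddings -/

/-- **A directed system of `C^∞` manifolds along injective local diffeomorphisms** (the transition
maps of the union of a chain of developments, Choquet-Bruhat–Geroch 1969, p. 333: smooth isometric
open embeddings `ψ_{αβ} : N_α → N_β` with `ψ_{αγ} = ψ_{βγ} ∘ ψ_{αβ}`): nonempty manifolds `obj i`
modelled on the normed space `E`, continuous transition maps `map i j h` (`i ≤ j`) forming a
directed system (`map i i = id`, `map j k ∘ map i j = map i k`), each an injective `C^∞` local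
diffeomorphism. [cite: ChoquetBruhatGeroch1969CMP, proof of Thm. 3 (p. 333)] -/
structure SmoothDirectLimitData (E : Type v) [NormedAddCommGroup E] [NormedSpace ℝ E]
    (ι : Type w) [Preorder ι] where
  /-- The pieces. -/
  obj : ι → Type u
  /-- Their topologies. -/
  [topologicalSpace : ∀ i, TopologicalSpace (obj i)]
  /-- Their atlases. -/
  [chartedSpace : ∀ i, ChartedSpace E (obj i)]
  /-- The pieces are `C^∞` manifolds. -/
  [isManifold : ∀ i, IsManifold 𝓘(ℝ, E) ∞ (obj i)]
  /-- The pieces are nonempty. -/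
  [nonempty : ∀ i, Nonempty (obj i)]
  /-- The transition maps. -/
  map : ∀ i j, i ≤ j → C(obj i, obj j)
  /-- The transition maps form a directed system. -/
  [directedSystem : DirectedSystem obj (map · · ·)]
  /-- The transition maps are injective. -/
  injective : ∀ i j h, Injective (map i j h)
  /-- The transition maps are `C^∞` local diffeomorphisms. -/
  isLocalDiffeomorph : ∀ i j h, IsLocalDiffeomorph 𝓘(ℝ, E) 𝓘(ℝ, E) ∞ (map i j h)

namespace SmoothDirectLimitData

attribute [instance] SmoothDirectLimitData.topologicalSpace SmoothDirectLimitData.chartedSpace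
  SmoothDirectLimitData.isManifold SmoothDirectLimitData.nonempty
  SmoothDirectLimitData.directedSystem

variable {E : Type v} [NormedAddCommGroup E] [NormedSpace ℝ E] {ι : Type w} [Preorder ι]
  [IsDirectedOrder ι] (d : SmoothDirectLimitData.{u, v, w} E ι)

/-! ### The limit space and the canonical maps -/

/-- The direct limit `lim obj` of the system (Mathlib's `DirectLimit`: the quotient of `Σ i, obj i`
by eventual agreement). [cite: ChoquetBruhatGeroch1969CMP, proof of Thm. 3 (p. 333)] -/
def Limit : Type (max u w) := DirectLimit d.obj d.map

/-- The quotient topology on the limit. [folklore] -/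
instance instTopologicalSpace : TopologicalSpace d.Limit :=
  inferInstanceAs (TopologicalSpace (DirectLimit d.obj d.map))

/-- The canonical map `obj i → lim obj`. [folklore] -/
def incl (i : ι) (x : d.obj i) : d.Limit := (⟦⟨i, x⟩⟧ : DirectLimit d.obj d.map)

/-- Every point of the limit comes from some piece. [folklore] -/
theorem exists_eq_incl (z : d.Limit) : ∃ i x, z = d.incl i x := DirectLimit.exists_eq_mk d.map z

/-- Any two points of the limit come from a common piece. [folklore] -/
theorem exists_eq_incl₂ (z w : d.Limit) : ∃ i x y, z = d.incl i x ∧ w = d.incl i y :=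
  DirectLimit.exists_eq_mk₂ d.map z w

/-- The canonical maps are compatible with the transition maps: `incl j (map i j x) = incl i x`.
[folklore] -/
@[simp] theorem incl_map {i j : ι} (h : i ≤ j) (x : d.obj i) : d.incl j (d.map i j h x) = d.incl i x :=
  DirectLimit.mk_apply (f := d.map) i j x h

/-- `incl i x = incl j y` iff `x` and `y` agree in some later piece. [folklore] -/
theorem incl_eq_incl_iff {i j : ι} {x : d.obj i} {y : d.obj j} :
    d.incl i x = d.incl j y ↔ ∃ (k : ι) (hik : i ≤ k) (hjk : j ≤ k), d.map i k hik x = d.map j k hjk y :=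
  Literature.Topology.directLimitMk_eq_iff d.map

/-- **`incl i x = incl j y` iff `x` and `y` agree in ANY common later piece** (injectivity of the
transition maps). [folklore] -/
theorem incl_eq_incl_iff_of_le {i j k : ι} (hik : i ≤ k) (hjk : j ≤ k) {x : d.obj i} {y : d.obj j} :
    d.incl i x = d.incl j y ↔ d.map i k hik x = d.map j k hjk y := by
  rw [incl_eq_incl_iff]
  constructor
  · rintro ⟨l, hil, hjl, hl⟩
    obtain ⟨m, hkm, hlm⟩ := exists_ge_ge k l
    apply d.injective k m hkm
    rw [DirectedSystem.map_map' d.map hik hkm, DirectedSystem.map_map' d.map hjk hkm,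
      ← DirectedSystem.map_map' d.map hil hlm, ← DirectedSystem.map_map' d.map hjl hlm, hl]
  · exact fun h ↦ ⟨k, hik, hjk, h⟩

omit [IsDirectedOrder ι] in
/-- The transition maps are open embeddings. [folklore] -/
theorem isOpenEmbedding_map (i j : ι) (h : i ≤ j) : IsOpenEmbedding (d.map i j h) :=
  (d.isLocalDiffeomorph i j h).isOpenEmbedding_of_injective (d.injective i j h)

/-- The canonical maps are open embeddings. [folklore] -/
theorem isOpenEmbedding_incl (i : ι) : IsOpenEmbedding (d.incl i) :=
  Literature.Topology.isOpenEmbedding_directLimitMk d.map d.injective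
    (fun i j h ↦ (d.isOpenEmbedding_map i j h).isOpenMap) i

/-- The canonical maps are continuous. [folklore] -/
theorem continuous_incl (i : ι) : Continuous (d.incl i) := (d.isOpenEmbedding_incl i).continuous

/-- The canonical maps are injective. [folklore] -/
theorem incl_injective (i : ι) : Injective (d.incl i) := (d.isOpenEmbedding_incl i).injective

/-- The image of a piece is open. [folklore] -/
theorem isOpen_range_incl (i : ι) : IsOpen (range (d.incl i)) := (d.isOpenEmbedding_incl i).isOpen_range

/-- The images of the pieces increase. [folklore] -/
theorem range_incl_mono {i j : ι} (h : i ≤ j) : range (d.incl i) ⊆ range (d.incl j) :=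
  Literature.Topology.range_directLimitMk_mono d.map h

/-- The limit is Hausdorff if the pieces are. [folklore] -/
instance instT2Space [∀ i, T2Space (d.obj i)] : T2Space d.Limit :=
  Literature.Topology.t2Space_directLimit d.map d.injective
    fun i j h ↦ (d.isOpenEmbedding_map i j h).isOpenMap

/-- The limit is connected if the pieces are (the index order being nonempty). [folklore] -/
instance instConnectedSpace [Nonempty ι] [∀ i, ConnectedSpace (d.obj i)] : ConnectedSpace d.Limit :=
  Literature.Topology.connectedSpace_directLimit d.map

/-! ### The change-of-piece partial diffeomorphisms -/

/-- **The overlap map** `φ_{jk}⁻¹ ∘ φ_{ik} : obj i ⇀ obj j` through a common later piece `k`: the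
partial homeomorphism with source `φ_{ik}⁻¹(range φ_{jk})` describing which points of `obj i` and
`obj j` are identified in the limit (`incl_eq_incl_iff_overlap`). [folklore] -/
def overlap (i j k : ι) (hik : i ≤ k) (hjk : j ≤ k) : OpenPartialHomeomorph (d.obj i) (d.obj j) :=
  ((d.isOpenEmbedding_map i k hik).toOpenPartialHomeomorph (d.map i k hik)).trans
    ((d.isOpenEmbedding_map j k hjk).toOpenPartialHomeomorph (d.map j k hjk)).symm

omit [IsDirectedOrder ι] in
/-- The source of the overlap map. [folklore] -/
theorem mem_overlap_source {i j k : ι} {hik : i ≤ k} {hjk : j ≤ k} {x : d.obj i} :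
    x ∈ (d.overlap i j k hik hjk).source ↔ d.map i k hik x ∈ range (d.map j k hjk) := by
  simp [overlap]

omit [IsDirectedOrder ι] in
/-- The overlap map followed by `φ_{jk}` is `φ_{ik}`. [folklore] -/
theorem map_overlap {i j k : ι} {hik : i ≤ k} {hjk : j ≤ k} {x : d.obj i}
    (hx : x ∈ (d.overlap i j k hik hjk).source) :
    d.map j k hjk (d.overlap i j k hik hjk x) = d.map i k hik x := by
  rw [mem_overlap_source] at hx
  simp only [overlap, coe_trans, comp_apply, IsOpenEmbedding.toOpenPartialHomeomorph_apply]
  exact (d.isOpenEmbedding_map j k hjk).toOpenPartialHomeomorph_right_inv _ hx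

/-- **`incl i x = incl j y` iff `x` lies in the source of the overlap map and is sent to `y`.**
[folklore] -/
theorem incl_eq_incl_iff_overlap {i j k : ι} (hik : i ≤ k) (hjk : j ≤ k) {x : d.obj i}
    {y : d.obj j} :
    d.incl i x = d.incl j y ↔
      x ∈ (d.overlap i j k hik hjk).source ∧ d.overlap i j k hik hjk x = y := by
  rw [d.incl_eq_incl_iff_of_le hik hjk, mem_overlap_source]
  constructor
  · intro h
    refine ⟨⟨y, h.symm⟩, ?_⟩
    simp only [overlap, coe_trans, comp_apply, IsOpenEmbedding.toOpenPartialHomeomorph_apply, h]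
    exact (d.isOpenEmbedding_map j k hjk).toOpenPartialHomeomorph_left_inv _
  · rintro ⟨hx, rfl⟩
    exact (d.map_overlap (d.mem_overlap_source.2 hx)).symm

omit [IsDirectedOrder ι] in
/-- The overlap maps are smooth (a local diffeomorphism followed by the smooth inverse of an
injective local diffeomorphism, `IsLocalDiffeomorph.contMDiffOn_symm_of_injective`). [folklore] -/
theorem contMDiffOn_overlap (i j k : ι) (hik : i ≤ k) (hjk : j ≤ k) :
    ContMDiffOn 𝓘(ℝ, E) 𝓘(ℝ, E) ∞ (d.overlap i j k hik hjk) (d.overlap i j k hik hjk).source := by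
  have h1 : ContMDiffOn 𝓘(ℝ, E) 𝓘(ℝ, E) ∞ (d.map i k hik) (d.overlap i j k hik hjk).source :=
    (d.isLocalDiffeomorph i k hik).contMDiff.contMDiffOn
  have h2 := (d.isLocalDiffeomorph j k hjk).contMDiffOn_symm_of_injective (d.injective j k hjk)
  refine (h2.comp h1 fun x hx ↦ d.mem_overlap_source.1 hx).congr fun x _ ↦ ?_
  simp only [overlap, coe_trans, comp_apply, IsOpenEmbedding.toOpenPartialHomeomorph_apply]

/-! ### Charts of the limit -/

/-- **The lift to the limit of a chart of a piece**: on `incl i '' e.source` it is `e ∘ (incl i)⁻¹`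
(Mathlib's `OpenPartialHomeomorph.lift_openEmbedding`). [folklore] -/
def chartLift (i : ι) (e : OpenPartialHomeomorph (d.obj i) E) : OpenPartialHomeomorph d.Limit E :=
  e.lift_openEmbedding (d.isOpenEmbedding_incl i)

/-- The source of a lifted chart. [folklore] -/
@[simp] theorem chartLift_source (i : ι) (e : OpenPartialHomeomorph (d.obj i) E) :
    (d.chartLift i e).source = d.incl i '' e.source := rfl

/-- The target of a lifted chart. [folklore] -/
@[simp] theorem chartLift_target (i : ι) (e : OpenPartialHomeomorph (d.obj i) E) :
    (d.chartLift i e).target = e.target := rfl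

/-- A lifted chart on the image of its piece: `chartLift i e (incl i x) = e x`. [folklore] -/
@[simp] theorem chartLift_apply_incl (i : ι) (e : OpenPartialHomeomorph (d.obj i) E) (x : d.obj i) :
    d.chartLift i e (d.incl i x) = e x :=
  e.lift_openEmbedding_apply (d.isOpenEmbedding_incl i)

/-- The inverse of a lifted chart: `(chartLift i e).symm u = incl i (e.symm u)`. [folklore] -/
@[simp] theorem chartLift_symm_apply (i : ι) (e : OpenPartialHomeomorph (d.obj i) E) (u : E) :
    (d.chartLift i e).symm u = d.incl i (e.symm u) := rfl

/-- **Changes of lifted charts are smooth**: for charts `e`, `e'` of the maximal atlases of the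
pieces `i`, `j` and a common later piece `k`, the change of charts
`(chartLift i e).symm ≫ chartLift j e'` is, on its source, `e' ∘ (φ_{jk}⁻¹ ∘ φ_{ik}) ∘ e.symm`
(cf. `Literature.Topology.FourManifolds.contDiffOn_lift_symm_trans_lift` for two pieces; Kosinski,
*Differential Manifolds*, VI.1). [cite: ChoquetBruhatGeroch1969CMP, proof of Thm. 3 (p. 333)] -/
theorem contDiffOn_chartLift_symm_trans_chartLift {i j k : ι} (hik : i ≤ k) (hjk : j ≤ k)
    {e : OpenPartialHomeomorph (d.obj i) E} (he : e ∈ IsManifold.maximalAtlas 𝓘(ℝ, E) ∞ (d.obj i))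
    {e' : OpenPartialHomeomorph (d.obj j) E}
    (he' : e' ∈ IsManifold.maximalAtlas 𝓘(ℝ, E) ∞ (d.obj j)) :
    ContDiffOn ℝ ∞ ((d.chartLift i e).symm ≫ₕ d.chartLift j e')
      ((d.chartLift i e).symm ≫ₕ d.chartLift j e').source := by
  set θ := d.overlap i j k hik hjk with hθ
  set F : E → E := e' ∘ θ ∘ e.symm with hF
  set S : Set E := {u | u ∈ e.target ∧ e.symm u ∈ θ.source ∧ θ (e.symm u) ∈ e'.source} with hS
  have hmem : ∀ u ∈ ((d.chartLift i e).symm ≫ₕ d.chartLift j e').source,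
      u ∈ S ∧ ((d.chartLift i e).symm ≫ₕ d.chartLift j e') u = F u := by
    intro u hu
    simp only [trans_source, symm_source, chartLift_target, mem_inter_iff, mem_preimage,
      chartLift_symm_apply, chartLift_source, mem_image] at hu
    obtain ⟨hu1, y, hy, hyu⟩ := hu
    obtain ⟨hx, hxy⟩ := (d.incl_eq_incl_iff_overlap hik hjk).1 hyu.symm
    refine ⟨⟨hu1, hx, hxy ▸ hy⟩, ?_⟩
    simp only [coe_trans, comp_apply, chartLift_symm_apply, hF]
    rw [← hyu, chartLift_apply_incl, ← hxy]
  have hsub : ((d.chartLift i e).symm ≫ₕ d.chartLift j e').source ⊆ S := fun u hu ↦ (hmem u hu).1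
  refine ContDiffOn.congr (ContDiffOn.mono ?_ hsub) fun u hu ↦ (hmem u hu).2
  rw [← contMDiffOn_iff_contDiffOn]
  have h1 : ContMDiffOn 𝓘(ℝ, E) 𝓘(ℝ, E) ∞ e.symm S :=
    (contMDiffOn_symm_of_mem_maximalAtlas he).mono fun u hu ↦ hu.1
  have h2 : ContMDiffOn 𝓘(ℝ, E) 𝓘(ℝ, E) ∞ (θ ∘ e.symm) S :=
    (d.contMDiffOn_overlap i j k hik hjk).comp h1 fun u hu ↦ hu.2.1
  exact (contMDiffOn_of_mem_maximalAtlas he').comp h2 fun u hu ↦ hu.2.2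

/-- **The limit as a charted space** on `E`: the atlas consists of the lifts of all charts of the
maximal `C^∞` atlases of the pieces; the preferred chart at `z = incl i x` is the lift of the
preferred chart at `x` for a chosen representative. [cite: ChoquetBruhatGeroch1969CMP, proof of Thm. 3 (p. 333)] -/
instance instChartedSpace : ChartedSpace E d.Limit where
  atlas := ⋃ i, d.chartLift i '' IsManifold.maximalAtlas 𝓘(ℝ, E) ∞ (d.obj i)
  chartAt z := d.chartLift (Classical.choose (d.exists_eq_incl z))
    (chartAt E (Classical.choose (Classical.choose_spec (d.exists_eq_incl z))))
  mem_chart_source z := by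
    refine ⟨Classical.choose (Classical.choose_spec (d.exists_eq_incl z)), mem_chart_source _ _, ?_⟩
    exact (Classical.choose_spec (Classical.choose_spec (d.exists_eq_incl z))).symm
  chart_mem_atlas z := mem_iUnion.2 ⟨_, _, IsManifold.chart_mem_maximalAtlas _, rfl⟩

/-- Description of the atlas of the limit. [folklore] -/
theorem mem_atlas_iff {e : OpenPartialHomeomorph d.Limit E} :
    e ∈ atlas E d.Limit ↔ ∃ i, ∃ f ∈ IsManifold.maximalAtlas 𝓘(ℝ, E) ∞ (d.obj i), d.chartLift i f = e := by
  change (e ∈ ⋃ i, d.chartLift i '' IsManifold.maximalAtlas 𝓘(ℝ, E) ∞ (d.obj i)) ↔ _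
  simp only [mem_iUnion, mem_image]

/-- Lifts of maximal-atlas charts of the pieces are charts of the limit. [folklore] -/
theorem chartLift_mem_atlas {i : ι} {e : OpenPartialHomeomorph (d.obj i) E}
    (he : e ∈ IsManifold.maximalAtlas 𝓘(ℝ, E) ∞ (d.obj i)) : d.chartLift i e ∈ atlas E d.Limit :=
  d.mem_atlas_iff.2 ⟨i, e, he, rfl⟩

/-- **The limit is a `C^∞` manifold** (changes of lifted charts are smooth through a common later
piece, `contDiffOn_chartLift_symm_trans_chartLift`). [cite: ChoquetBruhatGeroch1969CMP, proof of Thm. 3 (p. 333)] -/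
instance instIsManifold : IsManifold 𝓘(ℝ, E) ∞ d.Limit := by
  refine isManifold_of_contDiffOn _ _ _ fun e₁ e₂ he₁ he₂ ↦ ?_
  obtain ⟨i, e, he, rfl⟩ := d.mem_atlas_iff.1 he₁
  obtain ⟨j, e', he', rfl⟩ := d.mem_atlas_iff.1 he₂
  obtain ⟨k, hik, hjk⟩ := exists_ge_ge i j
  simp only [modelWithCornersSelf_coe, modelWithCornersSelf_coe_symm, CompTriple.comp_eq,
    range_id, inter_univ, preimage_id_eq, id_eq]
  exact d.contDiffOn_chartLift_symm_trans_chartLift hik hjk he he'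

/-- Lifted charts of maximal-atlas charts belong to the maximal atlas of the limit. [folklore] -/
theorem chartLift_mem_maximalAtlas {i : ι} {e : OpenPartialHomeomorph (d.obj i) E}
    (he : e ∈ IsManifold.maximalAtlas 𝓘(ℝ, E) ∞ (d.obj i)) :
    d.chartLift i e ∈ IsManifold.maximalAtlas 𝓘(ℝ, E) ∞ d.Limit :=
  IsManifold.subset_maximalAtlas (d.chartLift_mem_atlas he)

/-! ### The canonical maps are smooth local diffeomorphisms -/

/-- **The canonical maps `incl i : obj i → lim obj` are smooth**: near `x`, `incl i` is the
inverse of the lifted chart of `chartAt x` followed by `chartAt x`. [folklore] -/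
theorem contMDiff_incl (i : ι) : ContMDiff 𝓘(ℝ, E) 𝓘(ℝ, E) ∞ (d.incl i) := by
  intro x
  set e := chartAt E x with he
  have hem : e ∈ IsManifold.maximalAtlas 𝓘(ℝ, E) ∞ (d.obj i) := IsManifold.chart_mem_maximalAtlas x
  have hE := d.chartLift_mem_maximalAtlas hem
  have h : ContMDiffOn 𝓘(ℝ, E) 𝓘(ℝ, E) ∞ ((d.chartLift i e).symm ∘ e) e.source :=
    (contMDiffOn_symm_of_mem_maximalAtlas hE).comp (contMDiffOn_of_mem_maximalAtlas hem)
      fun y hy ↦ e.map_source hy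
  refine (h.congr fun y hy ↦ ?_).contMDiffAt (e.open_source.mem_nhds (mem_chart_source E x))
  simp only [comp_apply, chartLift_symm_apply, e.left_inv hy]

/-- **The inverse of `incl i` is smooth on its range**: near `incl i x` it is `(chartAt x).symm`
composed with the lifted chart. [folklore] -/
theorem contMDiffOn_inclSymm (i : ι) :
    ContMDiffOn 𝓘(ℝ, E) 𝓘(ℝ, E) ∞ ((d.isOpenEmbedding_incl i).toOpenPartialHomeomorph (d.incl i)).symm
      (range (d.incl i)) := by
  rintro _ ⟨x, rfl⟩
  set e := chartAt E x with he
  have hem : e ∈ IsManifold.maximalAtlas 𝓘(ℝ, E) ∞ (d.obj i) := IsManifold.chart_mem_maximalAtlas x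
  have hE := d.chartLift_mem_maximalAtlas hem
  set g := ((d.isOpenEmbedding_incl i).toOpenPartialHomeomorph (d.incl i)).symm with hg
  have h : ContMDiffOn 𝓘(ℝ, E) 𝓘(ℝ, E) ∞ (e.symm ∘ d.chartLift i e) (d.chartLift i e).source :=
    (contMDiffOn_symm_of_mem_maximalAtlas hem).comp (contMDiffOn_of_mem_maximalAtlas hE)
      fun z hz ↦ (d.chartLift i e).map_source hz
  have hev : EqOn g (e.symm ∘ d.chartLift i e) (d.chartLift i e).source := by
    rintro _ ⟨y, hy, rfl⟩
    simp only [hg, comp_apply, chartLift_apply_incl, e.left_inv hy]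
    exact (d.isOpenEmbedding_incl i).toOpenPartialHomeomorph_left_inv _
  have hnhds : (d.chartLift i e).source ∈ 𝓝 (d.incl i x) :=
    (d.chartLift i e).open_source.mem_nhds ⟨x, mem_chart_source E x, rfl⟩
  exact ((h.congr hev).contMDiffAt hnhds).contMDiffWithinAt

/-- **The canonical maps are `C^∞` local diffeomorphisms** (indeed diffeomorphisms onto their open
ranges). [folklore] -/
theorem isLocalDiffeomorph_incl (i : ι) : IsLocalDiffeomorph 𝓘(ℝ, E) 𝓘(ℝ, E) ∞ (d.incl i) := by
  intro x
  set e := (d.isOpenEmbedding_incl i).toOpenPartialHomeomorph (d.incl i) with he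
  refine ⟨{ toPartialEquiv := e.toPartialEquiv
            open_source := e.open_source
            open_target := e.open_target
            contMDiffOn_toFun := ?_
            contMDiffOn_invFun := ?_ }, ?_, fun y _ ↦ ?_⟩
  · exact (d.contMDiff_incl i).contMDiffOn.congr fun y _ ↦ by simp [he]
  · have h := d.contMDiffOn_inclSymm i
    rw [← IsOpenEmbedding.toOpenPartialHomeomorph_target] at h
    exact h
  · simp [he]
  · simp [he]

end SmoothDirectLimitData

end Literature.Geometry.Manifold

end
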